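import Summits.QuantumFields.YangMills.Theorems.UnitScaleTiltNontrivial
import Literature.MathematicalPhysics.QuantumFieldTheory.Balaban1983to89.T3OSLawNontrivial
import HarnessLib

/-!
# `UnitScaleTiltNontrivialLabels` — the route's three cruxes give (NT3) at EVERY once-visiting label (all simple loops) and at the
# Polyakov labels (route `UnitScaleTilt`, rev 14; cell `ym3-torus`, seat `ym3-torus-p2` gen 15; companion of `UnitScaleTiltNontrivial`)

WHAT THIS IS NOT: not d = 4, not infinite volume, not a mass gap, not Clay; the three cruxes `MinimiserStabilityRegPr` (19200),
`FluctuationComparisonRegPrIntL` (20520), `HistoryTailL` (19936) are HYPOTHESES, as in `Theses.UnitScaleTilt.closes`.  The sibling file proved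
non-triviality at the plaquette labels; the Literature module `T3NontrivialityFromTiltLabels` (same gen) extends the atomless-law input to every
label whose unit-lattice representative visits some bond exactly once (one-link affine with a unit datum) and to the straight Polyakov labels.
This file composes: `ym3_uniformVariance_of_cruxes_of_split`, `ym3_uniformVariance_polyakov_of_cruxes`, and the LAW-FORM capstone
`osLaw_nontrivial_of_cruxes` (over `T3OSLawNontrivial`, same gen): the three cruxes give, on every three-torus and for every `γ > 0`, ONE
OS-positive, torus-covariant, centre-symmetric continuum loop law, unique, with non-degenerate non-Gaussian marginals at every simple-loop label.

References: C. King, CMP 102 (1986) [King1986] (Thm 3.4 p.656); A. Jaffe, E. Witten [JaffeWittenClay2006] (§4 p.6); S. Chatterjee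
[Chatterjee2019YMProbabilists] (§6 p.19); L. McLerran, B. Svetitsky [McLerranSvetitsky1981].
-/

noncomputable section

open MeasureTheory Filter Topology Set
open Literature.MathematicalPhysics.QuantumFieldTheory.Balaban1983to89
open Literature.MathematicalPhysics.QuantumFieldTheory.Balaban1983to89.T3ContinuumYM3Torus
open Literature.MathematicalPhysics.QuantumFieldTheory.Balaban1983to89.T3UnitScaleTilt
open Literature.MathematicalPhysics.QuantumFieldTheory.Balaban1983to89.T3UnitLawDensityEML (ℰp measurableE_ℰp)
open Literature.MathematicalPhysics.QuantumFieldTheory.Balaban1983to89.T3NontrivialityFromTiltLabels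
open Literature.MathematicalPhysics.QuantumFieldTheory.Balaban1983to89.T3OSLawNontrivial
open Literature.MathematicalPhysics.QuantumFieldTheory.Balaban1983to89.T4Continuum
open Literature.MathematicalPhysics.QuantumFieldTheory.Balaban1983to89.T4LimitLaw
open Summit.QuantumFields.YangMills.Theses.UnitScaleTilt

namespace Summit.QuantumFields.YangMills.Theorems.UnitScaleTiltNontrivial

/-- **THE THREE CRUXES GIVE (NT3) AT EVERY ONCE-VISITING LABEL**: for every family `F`, every `γ > 0` and every label `C` whose unit-lattice
representative `C.atLevel 0 = γ₁ ++ s :: γ₂` visits the bond of `s` only at `s` (every simple loop), `∃ c, UniformVariance (F.scheme ℰp γ) C c`.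
[cite: JaffeWittenClay2006, §4 p.6] -/
theorem ym3_uniformVariance_of_cruxes_of_split (h200 : MinimiserStabilityRegPr) (h201 : FluctuationComparisonRegPrIntL) (hK2 : HistoryTailL)
    (F : T3Family) {γ : ℝ} (hγ : 0 < γ) (C : ULoop3 F) (γ₁ γ₂ : List (LStep (F.P 0) 0)) (s : LStep (F.P 0) 0)
    (hC : C.1.atLevel 0 = γ₁ ++ s :: γ₂) (h₁ : ∀ s' ∈ γ₁, s'.bond ≠ s.bond) (h₂ : ∀ s' ∈ γ₂, s'.bond ≠ s.bond) :
    ∃ c : ℝ, UniformVariance (F.scheme ℰp γ) C c := by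
  obtain ⟨n, r, w, w', hr, hw, hw', h⟩ := exists_refine_unitTiltTail h200 h201 hK2 F hγ
  exact exists_uniformVariance_of_refine_unitTiltTail_of_split F n hγ.le h hr hw hw' C γ₁ γ₂ s hC h₁ h₂

/-- **THE THREE CRUXES GIVE (NT3) AT THE POLYAKOV LABELS**: for every family `F`, every `γ > 0`, every direction and base point,
`∃ c, UniformVariance (F.scheme ℰp γ) (ULoop3.polyakov μ x) c` — the order parameter of gen 6's centre-symmetry analysis has a non-degenerate
limit law (its mean is `0` by `T3CentreSymmetry.expectAt_eq_zero_of_odd_SU2`; here its variance stays bounded below). [cite: McLerranSvetitsky1981] -/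
theorem ym3_uniformVariance_polyakov_of_cruxes (h200 : MinimiserStabilityRegPr) (h201 : FluctuationComparisonRegPrIntL) (hK2 : HistoryTailL)
    (F : T3Family) {γ : ℝ} (hγ : 0 < γ) (μ : Fin 3) (x : F.USite) :
    ∃ c : ℝ, UniformVariance (F.scheme ℰp γ) (ULoop3.polyakov μ x) c := by
  obtain ⟨n, r, w, w', hr, hw, hw', h⟩ := exists_refine_unitTiltTail h200 h201 hK2 F hγ
  exact exists_uniformVariance_polyakov_of_refine_unitTiltTail F n hγ.le h hr hw hw' μ x

/-- **RUNG R3 IN LAW FORM WITH NON-TRIVIALITY, FROM THE THREE CRUXES**: for every torus family `F` and every `γ > 0` there is ONE Borel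
probability law `ν` on `[-1,1]^{ULoop3 F}` with `IsOSContinuumLaw3 F hE hγ ν` (weak limit of the loop laws along the full sequence, moments, OS
positivity on every strict cone, `T₁ ⋊ B₃` invariance), UNIQUE, CENTRE-SYMMETRIC (`centreFlip`), and for EVERY label whose unit-lattice representative
visits some bond exactly once the `C`-marginal has POSITIVE variance and is NOT Gaussian — what OS reconstruction on one torus consumes, plus
non-triviality, all from `MinimiserStabilityRegPr ∧ FluctuationComparisonRegPrIntL ∧ HistoryTailL`. [cite: JaffeWittenClay2006, §4 p.6 and §6.5 p.11] -/
theorem osLaw_nontrivial_of_cruxes (h200 : MinimiserStabilityRegPr) (h201 : FluctuationComparisonRegPrIntL) (hK2 : HistoryTailL)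
    (F : T3Family) {γ : ℝ} (hγ : 0 < γ) :
    ∃ ν : MeasureTheory.ProbabilityMeasure (Cube (ULoop3 F)), IsOSContinuumLaw3 F measurableE_ℰp hγ.le ν ∧
      (∀ ν' : MeasureTheory.ProbabilityMeasure (Cube (ULoop3 F)), IsOSContinuumLaw3 F measurableE_ℰp hγ.le ν' → ν' = ν) ∧
      (∀ μ : Fin 3, (ν : Measure (Cube (ULoop3 F))).map (centreFlip μ) = ν) ∧
      ∀ (C : ULoop3 F) (γ₁ γ₂ : List (LStep (F.P 0) 0)) (s : LStep (F.P 0) 0), C.1.atLevel 0 = γ₁ ++ s :: γ₂ →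
        (∀ s' ∈ γ₁, s'.bond ≠ s.bond) → (∀ s' ∈ γ₂, s'.bond ≠ s.bond) →
          0 < ProbabilityTheory.variance (fun y => ((y C : Set.Icc (-1 : ℝ) 1) : ℝ)) (ν : Measure (Cube (ULoop3 F))) ∧
          ∀ (m : ℝ) (v : NNReal), (ν : Measure (Cube (ULoop3 F))).map (fun y => ((y C : Set.Icc (-1 : ℝ) 1) : ℝ)) ≠
            ProbabilityTheory.gaussianReal m v := by
  obtain ⟨n, r, w, w', hr, hw, hw', h⟩ := exists_refine_unitTiltTail h200 h201 hK2 F hγ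
  exact exists_osLaw_nontrivial_of_refine_unitTiltTail F n hγ.le h hr hw hw'

end Summit.QuantumFields.YangMills.Theorems.UnitScaleTiltNontrivial

end
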